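import Mathlib
import HarnessLib

/-!
# `NoHeavyLowerTail` (stmt-CriticalPhenomena-4575) — swap targets are reached through one port only (L5.2′ of U1-PROOF.md; blueprint B5c)

Support file (prover `prim-gen-swap` gen 13; `--supports stmt-CriticalPhenomena-4575`).  No definitions, no named facts, no sorries.

L5.2′ of the seat memo U1-PROOF.md (gen-13 referee addition, §5): a credit configuration `ω′` containing two child edges `A₁ = {r, d₁}`,
`A₂ = {r, d₂}` (`d₁ ≠ d₂`) cannot be the Φ-target of a unit swapped in through `d₁` AND of a unit swapped in through `d₂`.  Indeed the two
pre-images are `S₁ = ω′ − A₁ + X₁`, `S₂ = ω′ − A₂ + X₂` with chord hubs, `X₁ ∋ d₁` avoiding `r` and adjacent to everything in `S₁` (only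
this much of the symmetric data is needed); each `S_i` is either a STAR
configuration (every class through one port `v_i ≠ r`, at least two chords) or has a first open forest class `J_i ∉ child(r)` above `A_i`
((Φ4)); the four combinations contradict injectivity of port pairs, `hforest` (the leaf end of `A_i` is `d_i`), or the order.

* `StarSet.swap_targets_one_port`.
-/

namespace Summit.CriticalPhenomena.PercolationContinuityZ3.Theorems

open Finset
open scoped BigOperators

namespace StarSet

variable {ι V : Type*} [LinearOrder ι]

/-- **L5.2′ of U1-PROOF.md: no Φ-target is reached through two different ports.**  See the file header for the hypotheses. -/
theorem swap_targets_one_port (P P' : ι → V) (hinj : Function.Injective fun X => (s(P X, P' X) : Sym2 V)) (r : V) (F : Finset ι)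
    (hforest : ∀ K ∈ F, ∀ I ∈ F, K < I → P' K ≠ P I ∧ P' K ≠ P' I)
    {d₁ d₂ : V} (hd : d₁ ≠ d₂)
    {A₁ A₂ X₁ X₂ : ι} (hA₁F : A₁ ∈ F) (hA₁ : P A₁ = r ∧ P' A₁ = d₁) (hA₂F : A₂ ∈ F) (hA₂ : P A₂ = r ∧ P' A₂ = d₂)
    (hX₁F : X₁ ∉ F) (hX₁r : P X₁ ≠ r ∧ P' X₁ ≠ r) (hX₁d : P X₁ = d₁ ∨ P' X₁ = d₁)
    (hX₂F : X₂ ∉ F)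
    (ω' S₁ S₂ : Finset ι) (hA₁ω : A₁ ∈ ω') (hA₂ω : A₂ ∈ ω')
    (hS₁ : ∀ Y, Y ∈ S₁ ↔ Y = X₁ ∨ (Y ∈ ω' ∧ Y ≠ A₁)) (hS₂ : ∀ Y, Y ∈ S₂ ↔ Y = X₂ ∨ (Y ∈ ω' ∧ Y ≠ A₂))
    (hΩ₁ : ∀ Y ∈ S₁, P X₁ = P Y ∨ P X₁ = P' Y ∨ P' X₁ = P Y ∨ P' X₁ = P' Y)
    (hcase₁ : (∃ v, v ≠ r ∧ (∀ Y ∈ S₁, P Y = v ∨ P' Y = v) ∧ ∃ X' ∈ S₁, X' ≠ X₁ ∧ X' ∉ F) ∨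
      (∃ J ∈ S₁, J ∈ F ∧ (∀ I ∈ S₁, I ∈ F → J ≤ I) ∧ P J ≠ r ∧ A₁ < J))
    (hcase₂ : (∃ v, v ≠ r ∧ (∀ Y ∈ S₂, P Y = v ∨ P' Y = v) ∧ ∃ X' ∈ S₂, X' ≠ X₂ ∧ X' ∉ F) ∨
      (∃ J ∈ S₂, J ∈ F ∧ (∀ I ∈ S₂, I ∈ F → J ≤ I) ∧ P J ≠ r ∧ A₂ < J)) : False := by
  have hA₁₂ : A₁ ≠ A₂ := fun h => hd (hA₁.2.symm.trans (h ▸ hA₂.2))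
  have hA₂S₁ : A₂ ∈ S₁ := (hS₁ A₂).2 (Or.inr ⟨hA₂ω, hA₁₂.symm⟩)
  have hA₁S₂ : A₁ ∈ S₂ := (hS₂ A₁).2 (Or.inr ⟨hA₁ω, hA₁₂⟩)
  -- `X₁ ∋ d₂` (adjacent to `A₂`, avoids `r`)
  have hX₁d₂ : P X₁ = d₂ ∨ P' X₁ = d₂ := by
    rcases hΩ₁ A₂ hA₂S₁ with h | h | h | h
    · exact absurd (h.trans hA₂.1) hX₁r.1
    · exact Or.inl (h.trans hA₂.2)
    · exact absurd (h.trans hA₂.1) hX₁r.2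
    · exact Or.inr (h.trans hA₂.2)
  -- a class containing both `d₁` and `d₂` is `X₁` 
  have hpair : ∀ Y : ι, (P Y = d₁ ∨ P' Y = d₁) → (P Y = d₂ ∨ P' Y = d₂) → (s(P Y, P' Y) : Sym2 V) = s(d₁, d₂) := by
    intro Y h1 h2
    rcases h1 with h1 | h1 <;> rcases h2 with h2 | h2
    · exact absurd (h1.symm.trans h2) hd
    · rw [h1, h2]
    · rw [h1, h2]; exact Sym2.eq_swap
    · exact absurd (h1.symm.trans h2) hd
  have hsX₁ := hpair X₁ hX₁d hX₁d₂
  have hboth : ∀ Y : ι, (P Y = d₁ ∨ P' Y = d₁) → (P Y = d₂ ∨ P' Y = d₂) → Y = X₁ := fun Y h1 h2 =>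
    hinj ((hpair Y h1 h2).trans hsX₁.symm)
  -- in the STAR case the centre of `S₁` is `d₂` and that of `S₂` is `d₁`
  have hstar₁ : ∀ v, v ≠ r → (∀ Y ∈ S₁, P Y = v ∨ P' Y = v) → v = d₂ := by
    intro v hvr hv
    rcases hv A₂ hA₂S₁ with h | h
    · exact absurd (h.symm.trans hA₂.1) hvr
    · rw [← h, hA₂.2]
  have hstar₂ : ∀ v, v ≠ r → (∀ Y ∈ S₂, P Y = v ∨ P' Y = v) → v = d₁ := by
    intro v hvr hv
    rcases hv A₁ hA₁S₂ with h | h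
    · exact absurd (h.symm.trans hA₁.1) hvr
    · rw [← h, hA₁.2]
  -- a forest class of `S₁` other than the child edges lies in `S₂`, and vice versa
  have hFS₁S₂ : ∀ J ∈ S₁, J ∈ F → P J ≠ r → J ∈ S₂ := by
    intro J hJS hJF hJr
    have hJX : J ≠ X₁ := fun h => hX₁F (h ▸ hJF)
    have hJω : J ∈ ω' ∧ J ≠ A₁ := ((hS₁ J).1 hJS).resolve_left hJX
    exact (hS₂ J).2 (Or.inr ⟨hJω.1, fun h => hJr (h ▸ hA₂.1)⟩)
  have hFS₂S₁ : ∀ J ∈ S₂, J ∈ F → P J ≠ r → J ∈ S₁ := by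
    intro J hJS hJF hJr
    have hJX : J ≠ X₂ := fun h => hX₂F (h ▸ hJF)
    have hJω : J ∈ ω' ∧ J ≠ A₂ := ((hS₂ J).1 hJS).resolve_left hJX
    exact (hS₁ J).2 (Or.inr ⟨hJω.1, fun h => hJr (h ▸ hA₁.1)⟩)
  rcases hcase₁ with ⟨v₁, hv₁r, hv₁, X', hX'S, hX'X, hX'F⟩ | ⟨J₁, hJ₁S, hJ₁F, hJ₁min, hJ₁r, hAJ₁⟩
  · have hv₁d : v₁ = d₂ := hstar₁ v₁ hv₁r hv₁
    subst hv₁d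
    rcases hcase₂ with ⟨v₂, hv₂r, hv₂, -⟩ | ⟨J₂, hJ₂S, hJ₂F, hJ₂min, hJ₂r, hAJ₂⟩
    · -- both stars: the second chord `X'` of `S₁` lies in `S₂`, contains `d₁` and `d₂`, so equals `X₁`
      have hv₂d : v₂ = d₁ := hstar₂ v₂ hv₂r hv₂
      subst hv₂d
      have hX'ω : X' ∈ ω' ∧ X' ≠ A₁ := ((hS₁ X').1 hX'S).resolve_left hX'X
      have hX'S₂ : X' ∈ S₂ := (hS₂ X').2 (Or.inr ⟨hX'ω.1, fun h => hX'F (h ▸ hA₂F)⟩)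
      exact hX'X (hboth X' (hv₂ X' hX'S₂) (hv₁ X' hX'S))
    · -- `J₂ ∈ S₁` contains the centre `d₂ = P' A₂`, contradicting hforest for `A₂ < J₂`
      have hJ₂S₁ : J₂ ∈ S₁ := hFS₂S₁ J₂ hJ₂S hJ₂F hJ₂r
      have hJ₂d₂ := hv₁ J₂ hJ₂S₁
      have hf := hforest A₂ hA₂F J₂ hJ₂F hAJ₂
      rcases hJ₂d₂ with h | h
      · exact hf.1 (hA₂.2.trans h.symm)
      · exact hf.2 (hA₂.2.trans h.symm)
  · rcases hcase₂ with ⟨v₂, hv₂r, hv₂, -⟩ | ⟨J₂, hJ₂S, hJ₂F, hJ₂min, hJ₂r, hAJ₂⟩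
    · -- symmetric: `J₁ ∈ S₂` contains `d₁ = P' A₁`, contradicting hforest for `A₁ < J₁`
      have hv₂d : v₂ = d₁ := hstar₂ v₂ hv₂r hv₂
      subst hv₂d
      have hJ₁S₂ : J₁ ∈ S₂ := hFS₁S₂ J₁ hJ₁S hJ₁F hJ₁r
      have hJ₁d₁ := hv₂ J₁ hJ₁S₂
      have hf := hforest A₁ hA₁F J₁ hJ₁F hAJ₁
      rcases hJ₁d₁ with h | h
      · exact hf.1 (hA₁.2.trans h.symm)
      · exact hf.2 (hA₁.2.trans h.symm)
    · -- both have a first forest class: `J₁ = J₂`, and `A₁ < J₁ = J₂ ≤ A₁`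
      have hJ₁S₂ : J₁ ∈ S₂ := hFS₁S₂ J₁ hJ₁S hJ₁F hJ₁r
      have hJ₂S₁ : J₂ ∈ S₁ := hFS₂S₁ J₂ hJ₂S hJ₂F hJ₂r
      have h12 : J₁ ≤ J₂ := hJ₁min J₂ hJ₂S₁ hJ₂F
      have hJ₂A₁ : J₂ ≤ A₁ := hJ₂min A₁ hA₁S₂ hA₁F
      exact absurd (lt_of_lt_of_le hAJ₁ (h12.trans hJ₂A₁)) (lt_irrefl A₁)

end StarSet

end Summit.CriticalPhenomena.PercolationContinuityZ3.Theorems
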